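import Summits.ResolutionOfSingularities.ResolutionOfSingularities.Theorems.RadicialJungCleanModelsGiraudStepPointStalkTrichotomy
import Summits.ResolutionOfSingularities.ResolutionOfSingularities.Theorems.RadicialJungCleanModelsT2SncPointRsop
import Summits.ResolutionOfSingularities.ResolutionOfSingularities.Theorems.RadicialJungCleanModelsT2StepOfLemma23
import Summits.ResolutionOfSingularities.ResolutionOfSingularities.Theorems.RadicialJungCleanModelsT2Plumbing
import Summits.ResolutionOfSingularities.ResolutionOfSingularities.Theorems.RadicialJungCleanModelsPBasisStalk
import Summits.ResolutionOfSingularities.ResolutionOfSingularities.Theorems.RadicialJungCleanModelsKaehlerProjective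
import Summits.ResolutionOfSingularities.ResolutionOfSingularities.Theorems.RadicialJungCleanModelsCriticalSetClosed
import Summits.ResolutionOfSingularities.ResolutionOfSingularities.Theorems.RadicialJungCleanModelsStubFormalFibreReducedStalk
import Summits.ResolutionOfSingularities.ResolutionOfSingularities.Theorems.RadicialJungCleanModelsReadOffCritical
import Literature.AlgebraicGeometry.Resolution.AlterationsBoundarySmoothLocus
import Literature.AlgebraicGeometry.Resolution.PermissibleCentres
import HarnessLib

/-!
# Route `RadicialJung`, crux `CleanModels` (stmt-15917): Giraud's Lemme 2.3 over the centre and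
# the T2 step (T2 skeleton: `stub_lemma23`, hence `stub_step` / `step`)

Support file (OURS) for PROGRAMME-clean-dim2 / T2 (`HOME/L/res-L0-w81-pv-2/g5/T2Skeleton.lean`,
res-D-pv-030's `T2SkeletonB6.candidate.lean`), line `via-clean-models` of the crux
`DescentPerfectToAll` (stmt-0549). Nothing here is a statement of Hironaka's manuscript.

Assembly of the per-point Lemme 2.3 (`giraud23_trichotomy_stalk`, this seat) with the geometry of
the T2 programme: admissibility of the blown-up stage (`T2.adm_of_isPointBlowupComposition`,
res-L0-w81-pv-2), `E(f)` closed and `E(π^* f) = π⁻¹ E(f)` (res-L1-s13-pv-1, res-L0-w81-pv-2),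
the regular parameters and critical primes at a strict normal crossings point and over it
(res-D-pv-030's `…T2SncPointRsop`, `…T2CriticalPrimesStalk`), the `p`-basis of the stalk
containing the parameters (res-L0-w81-pv-2's `exists_isPBasisOver_stalk`), projectivity of `Ω`
(res-L0-w81-pv-2), the stalk dimension at closed points (Literature).

* `giraudColength_germ_ne_top` — **`c(X, f, ξ) < ∞`** at a Giraud-singular point;
* `giraud23_trichotomy_at` — **Lemme 2.3 at every Giraud-singular point over the centre**: the
  hypothesis `h23` of `T2.exists_step_of_trichotomy`;
* `exists_step_lemma23` — **the T2 step** (conclusion of the skeleton's `stub_step`, measure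
  `2·c + δ`), from `T2.exists_step_of_trichotomy`.

References: J. Giraud, Bull. SMF 111 (1983), Lemme 2.3, Thm. 2.4 [Giraud1983].
-/

noncomputable section

set_option linter.dupNamespace false -- mandated namespace of this single-conjunct summit

open CategoryTheory AlgebraicGeometry TopologicalSpace IsLocalRing
open Literature.RingTheory.PBasis Literature.AlgebraicGeometry.Resolution
open Summit.ResolutionOfSingularities.ResolutionOfSingularities.Theorems.RadicialJung.CleanModels.T2

namespace Summit.ResolutionOfSingularities.ResolutionOfSingularities.Theorems.RadicialJung.CleanModels

open Scheme.IdealSheafData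

/-! ## Point data at a Giraud-singular point -/

/-- Regular parameters `u ≠ v` at a closed point: `u ≠ 0` and `v ≠ 0`. [folklore] -/
theorem ne_zero_of_maximalIdeal_eq_span_pair {O : Type} [CommRing O] [IsRegularLocalRing O]
    (hdim : ringKrullDim O = 2) {u v : O} (huv : maximalIdeal O = Ideal.span {u, v}) :
    u ≠ 0 ∧ v ≠ 0 := by
  constructor
  · rintro rfl
    exact maximalIdeal_ne_span_singleton hdim v (by rw [huv, Ideal.span_insert_zero])
  · rintro rfl
    exact maximalIdeal_ne_span_singleton hdim u (by rw [huv, Set.pair_comm, Ideal.span_insert_zero])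

section OverField

variable (p : ℕ) [Fact p.Prime] (k : Type) [Field k] [CharP k p]
  (X : Scheme.{0}) [IsIntegral X] (q : X ⟶ Spec (.of k)) [LocallyOfFiniteType q]
  (hreg : Scheme.IsRegular X) (hdim : topologicalKrullDim X = 2) (f : Γ(X, ⊤))
  (hf : ∀ c : X.functionField, c ^ p ≠ X.presheaf.germ ⊤ (genericPoint X) trivial f)

include p k q hreg hdim in
/-- **The data at a Giraud-singular point `ξ`** (in an affine open `U` with `Ω` projective): the
stalk is regular of dimension `2` and of characteristic `p` with projective `Ω`; there are regular
parameters `u ≠ v` in a `p`-basis `Γ₀` of `𝒪_{X,ξ}` over `𝒪^p`, and a local equation `g = u` or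
`g = uv` of `E(f)` with `I(E(f))_ξ = (g)` and critical primes = the height-one primes over `g`.
[cite: Giraud1983, 1.3, 2.2] -/
theorem exists_pointData {U : X.Opens} (hU : IsAffineOpen U) [Module.Projective Γ(X, U) Ω[Γ(X, U)⁄ℤ]]
    (hE : IsClosed (derivCriticalSet X f)) {ξ : X} (hξU : ξ ∈ U) (hξ : IsGiraudSingularPoint X f ξ) :
    ∃ (_ : IsRegularLocalRing (X.presheaf.stalk ξ)) (_ : CharP (X.presheaf.stalk ξ) p)
      (_ : Module.Projective (X.presheaf.stalk ξ) Ω[X.presheaf.stalk ξ⁄ℤ])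
      (u v g : X.presheaf.stalk ξ) (Γ₀ : Set (X.presheaf.stalk ξ)),
      ringKrullDim (X.presheaf.stalk ξ) = 2 ∧ u ≠ v ∧
      maximalIdeal (X.presheaf.stalk ξ) = Ideal.span {u, v} ∧
      IsPBasisOver p (frobenius (X.presheaf.stalk ξ) p).range Γ₀ ∧ u ∈ Γ₀ ∧ v ∈ Γ₀ ∧
      (g = u ∨ g = u * v) ∧
      stalkIdeal (vanishingIdeal ⟨derivCriticalSet X f, hE⟩) ξ = Ideal.span {g} ∧
      ∀ P : Ideal (X.presheaf.stalk ξ),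
        P ∈ derivCriticalPrimes (X.presheaf.stalk ξ) (X.presheaf.germ ⊤ ξ trivial f) ↔
          (P.IsPrime ∧ P.height = 1 ∧ g ∈ P) := by
  haveI hR : IsRegularLocalRing (X.presheaf.stalk ξ) := hreg ξ
  have hdimξ : ringKrullDim (X.presheaf.stalk ξ) = 2 := by
    rw [ringKrullDim_stalk_eq_of_isClosed q hξ.1, hdim]
  obtain ⟨_, _⟩ := exists_algebra_essFiniteType_stalk k X q ξ
  haveI hch : CharP (X.presheaf.stalk ξ) p :=
    charP_of_injective_algebraMap (algebraMap k (X.presheaf.stalk ξ)).injective p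
  haveI hproj := projective_kaehler_stalk p k X q hreg ξ
  obtain ⟨u, v, -, hne, huv, hd1⟩ :=
    exists_rsop_derivCriticalPrimes_of_isStrictNormalCrossingsAt hU f hE hξU hξ.2.2.1 hdimξ
  obtain ⟨g, hg, hgI, hcrit⟩ : ∃ g : X.presheaf.stalk ξ, (g = u ∨ g = u * v) ∧
      stalkIdeal (vanishingIdeal ⟨derivCriticalSet X f, hE⟩) ξ = Ideal.span {g} ∧
      ∀ P : Ideal (X.presheaf.stalk ξ),
        P ∈ derivCriticalPrimes (X.presheaf.stalk ξ) (X.presheaf.germ ⊤ ξ trivial f) ↔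
          (P.IsPrime ∧ P.height = 1 ∧ g ∈ P) := by
    rcases hd1 with ⟨h1, h2⟩ | ⟨h1, h2⟩
    exacts [⟨u, Or.inl rfl, h1, h2⟩, ⟨u * v, Or.inr rfl, h1, h2⟩]
  have hspan : Ideal.span (Set.range ![u, v]) = maximalIdeal (X.presheaf.stalk ξ) := by
    rw [huv, Matrix.range_cons_cons_empty]
  obtain ⟨Γ₀, hsub, hΓ₀⟩ := exists_isPBasisOver_stalk p k q hreg hξ.1 ![u, v] hspan hdimξ
  exact ⟨hR, hch, hproj, u, v, g, Γ₀, hdimξ, hne, huv, hΓ₀, hsub ⟨0, rfl⟩, hsub ⟨1, rfl⟩, hg, hgI,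
    hcrit⟩

include p k q hreg hdim hf in
/-- **`c(X, f, ξ) < ∞` at a Giraud-singular point** of an admissible stage: `J(X, f, E(f))_ξ ≠ 0`
because `f_ξ ∉ 𝒪^p` and the local equation of `E(f)` lies in every critical prime
(`logDerivJacobianIdeal_ne_bot`), and the stalk is a two-dimensional regular local ring
(`giraudColength_ne_top_of_isRegularLocalRing`). [cite: Giraud1983, 2.2 and 2.4] -/
theorem giraudColength_germ_ne_top (ξ : X) (hξ : IsGiraudSingularPoint X f ξ) :
    giraudColength (X.presheaf.stalk ξ) (X.presheaf.germ ⊤ ξ trivial f) ≠ ⊤ := by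
  haveI : IsLocallyNoetherian X := LocallyOfFiniteType.isLocallyNoetherian q
  have hE : IsClosed (derivCriticalSet X f) := isClosed_derivCriticalSet p q hreg f
  obtain ⟨U, hU, hξU, -⟩ :=
    exists_isAffineOpen_mem_and_subset (X := X) (x := ξ) (U := ⊤) (Opens.mem_top _)
  haveI := projective_kaehler_sections_of_isAffineOpen p k q hreg hU
  obtain ⟨_, _, _, u, v, g, Γ₀, hdimξ, -, huv, hΓ₀, -, -, hg, -, hcrit⟩ :=
    exists_pointData p k X q hreg hdim f hU hE hξU hξ
  obtain ⟨δ, hδ₁, hδ₀⟩ := IsPBasisOver.exists_dual_derivations hΓ₀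
  have h0 := ne_zero_of_maximalIdeal_eq_span_pair hdimξ huv
  have hg0 : g ≠ 0 := by
    rcases hg with rfl | rfl
    exacts [h0.1, mul_ne_zero h0.1 h0.2]
  exact giraudColength_ne_top_of_isRegularLocalRing hdimξ
    (logDerivJacobianIdeal_ne_bot δ hδ₁ hδ₀ hΓ₀ (not_mem_range_frobenius_germ p f hf ξ) hg0
      fun P hP => ((hcrit P).mp hP).2.2)

include p k q hreg hdim hf in
/-- **Giraud's Lemme 2.3 at the points over the centre.** For an admissible stage `(X, f)`
(`X` integral, compact, regular, of dimension `2`, locally of finite type over a field of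
characteristic `p`, `f ∉ K(X)^p`), a Giraud-singular point `ξ`, the blowing up `π : X₁ → X` of
`ξ` and a Giraud-singular point `ξ₁` of `(X₁, π^* f)` over `ξ`: `c(ξ₁) < c(ξ)`, or `c(ξ₁) = c(ξ)`
with `ξ₁` a crossing point (`≠ 1` branch) and `ξ` a non-crossing point (one branch).
[cite: Giraud1983, Lemme 2.3 (i)–(iii)] -/
theorem giraud23_trichotomy_at [CompactSpace X] (ξ : X) (hξ : IsGiraudSingularPoint X f ξ)
    (X₁ : Scheme.{0}) (π : X₁ ⟶ X) (hπ : IsBlowup π (vanishingIdeal ⟨{ξ}, hξ.1⟩))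
    (ξ₁ : X₁) (hξ₁ : IsGiraudSingularPoint X₁ (π.appTop f) ξ₁) (heq : π ξ₁ = ξ) :
    giraudColength (X₁.presheaf.stalk ξ₁) (X₁.presheaf.germ ⊤ ξ₁ trivial (π.appTop f)) <
        giraudColength (X.presheaf.stalk ξ) (X.presheaf.germ ⊤ ξ trivial f) ∨
      (giraudColength (X₁.presheaf.stalk ξ₁) (X₁.presheaf.germ ⊤ ξ₁ trivial (π.appTop f)) =
          giraudColength (X.presheaf.stalk ξ) (X.presheaf.germ ⊤ ξ trivial f) ∧
        (derivCriticalPrimes (X₁.presheaf.stalk ξ₁)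
          (X₁.presheaf.germ ⊤ ξ₁ trivial (π.appTop f))).ncard ≠ 1 ∧
        (derivCriticalPrimes (X.presheaf.stalk ξ)
          (X.presheaf.germ ⊤ ξ trivial f)).ncard = 1) := by
  haveI : IsLocallyNoetherian X := LocallyOfFiniteType.isLocallyNoetherian q
  subst heq
  -- the blown-up stage is admissible
  have hne : ({π ξ₁} : Set X) ≠ Set.univ :=
    singleton_ne_univ_of_isGiraudSingularPoint (by rw [hdim]; decide) hξ
  obtain ⟨_, _, _, hreg₁, hdimX₁, -⟩ := adm_of_isPointBlowupComposition p k q hreg hdim f hf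
    (IsPointBlowupComposition.single π (π ξ₁) hξ.1 hne hξ.2.1 hπ)
  haveI : IsLocallyNoetherian X₁ := LocallyOfFiniteType.isLocallyNoetherian (π ≫ q)
  haveI hR₁ : IsRegularLocalRing (X₁.presheaf.stalk ξ₁) := hreg₁ ξ₁
  have hdimξ₁ : ringKrullDim (X₁.presheaf.stalk ξ₁) = 2 := by
    rw [ringKrullDim_stalk_eq_of_isClosed (π ≫ q) hξ₁.1, hdimX₁]
  -- `E(f)` closed, `E(π^* f) = π⁻¹ E(f)`, affine opens with projective `Ω`
  have hE : IsClosed (derivCriticalSet X f) := isClosed_derivCriticalSet p q hreg f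
  have hE₁ : derivCriticalSet X₁ (π.appTop f) = π ⁻¹' derivCriticalSet X f :=
    derivCriticalSet_eq_preimage_of_isBlowup p k X q hreg (π ≫ q) hreg₁ hπ f hξ.2.1
  obtain ⟨U, hU, hξU, -⟩ :=
    exists_isAffineOpen_mem_and_subset (X := X) (x := π ξ₁) (U := ⊤) (Opens.mem_top _)
  haveI := projective_kaehler_sections_of_isAffineOpen p k q hreg hU
  obtain ⟨U₁, hU₁, hξU₁, -⟩ :=
    exists_isAffineOpen_mem_and_subset (X := X₁) (x := ξ₁) (U := ⊤) (Opens.mem_top _)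
  haveI := projective_kaehler_sections_of_isAffineOpen p k (π ≫ q) hreg₁ hU₁
  -- the data at `π ξ₁`
  obtain ⟨_, _, _, u, v, g, Γ₀, hdimξ, hne', huv, hΓ₀, huΓ, hvΓ, hg, hgI, hcrit₀⟩ :=
    exists_pointData p k X q hreg hdim f hU hE hξU hξ
  -- the critical primes over the point, inside `K(X)`
  have hcrit₁ := mem_derivCriticalPrimes_range_stalkEmb_iff hξ.1 hπ f hE hE₁ hU₁ ξ₁ hξU₁ hgI
  have h := giraud23_trichotomy_stalk hπ ξ₁ (stalkIdeal_vanishingIdeal_singleton hξ.1) hdimξ hdimξ₁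
    u v huv hne' hΓ₀ huΓ hvΓ (X.presheaf.germ ⊤ (π ξ₁) trivial f)
    (not_mem_range_frobenius_germ p f hf (π ξ₁)) hξ.2.2.2 hg hcrit₀ hcrit₁
  have hgerm : (π.stalkMap ξ₁).hom (X.presheaf.germ ⊤ (π ξ₁) trivial f) =
      X₁.presheaf.germ ⊤ ξ₁ trivial (π.appTop f) :=
    Scheme.Hom.germ_stalkMap_apply π ⊤ ξ₁ trivial f
  rw [hgerm] at h
  exact h

include p k q hreg hdim hf in
/-- **The T2 step** (the skeleton's `stub_step`, measure `2·c(ξ) + δ(ξ)`): blowing up ONE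
Giraud-singular point `ξ` of an admissible stage with `E(f)` a strict normal crossings divisor gives
a stage with `E(f₁) = π⁻¹ E(f)` again a strict normal crossings divisor and a strictly smaller
measure in the Dershowitz–Manna order. [cite: Giraud1983, Lemme 2.3 and Thm. 2.4 (proof)] -/
theorem exists_step_lemma23 [CompactSpace X] (hsnc : IsStrictNormalCrossingsDivisor X (derivCriticalSet X f))
    (ξ : X) (hξ : IsGiraudSingularPoint X f ξ) :
    ∃ (X₁ : Scheme.{0}) (π : X₁ ⟶ X), IsPointBlowupComposition (derivCriticalSet X f) π ∧
      derivCriticalSet X₁ (π.appTop f) = π.base ⁻¹' derivCriticalSet X f ∧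
      IsStrictNormalCrossingsDivisor X₁ (derivCriticalSet X₁ (π.appTop f)) ∧
      ∀ (h : {x : X | IsGiraudSingularPoint X f x}.Finite)
        (h₁ : {x₁ : X₁ | IsGiraudSingularPoint X₁ (π.appTop f) x₁}.Finite),
        Multiset.IsDershowitzMannaLT
          (h₁.toFinset.val.map fun x₁ =>
            2 * (giraudColength (X₁.presheaf.stalk x₁)
                (X₁.presheaf.germ ⊤ x₁ trivial (π.appTop f))).toNat +
              if (derivCriticalPrimes (X₁.presheaf.stalk x₁)
                  (X₁.presheaf.germ ⊤ x₁ trivial (π.appTop f))).ncard = 1 then 1 else 0)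
          (h.toFinset.val.map fun x =>
            2 * (giraudColength (X.presheaf.stalk x) (X.presheaf.germ ⊤ x trivial f)).toNat +
              if (derivCriticalPrimes (X.presheaf.stalk x)
                  (X.presheaf.germ ⊤ x trivial f)).ncard = 1 then 1 else 0) :=
  exists_step_of_trichotomy p k X q hreg hdim f hsnc ξ hξ
    (giraudColength_germ_ne_top p k X q hreg hdim f hf ξ hξ)
    (giraud23_trichotomy_at p k X q hreg hdim f hf ξ hξ)

end OverField

end Summit.ResolutionOfSingularities.ResolutionOfSingularities.Theorems.RadicialJung.CleanModels

end
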